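import Summits.BirchSwinnertonDyer.Rank1Residual.F1Sign2.RaisingLawAtTwo
import Summits.BirchSwinnertonDyer.BirchSwinnertonDyer.Theses.ByReductionTypeAtTwo
import Summits.BirchSwinnertonDyer.Rank1Residual.F1Sign2.EggLemmaAtTwoProofs
import Literature.NumberTheory.EllipticCurves.CyclotomicIwasawaMainTheoremIrreducibleBaseChangeProofs
import HarnessLib.Audit.Tags
import HarnessLib

/-!
# ES-52 (cell `bsd-f1-sign2`, seat `-es` g41): THE REAL-ROOT FLAG AND THE 2-ADIC KUMMER LINES —
# the window of the Kummer tangent law, the middle-root obstruction, and the LINE-COINCIDENCE LAW `L₂(W) = L₂(F) ⟺ q(e₀) = e′₂`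

Crux workfile (planner seat; nothing here is proposed to `Theorems/`; the typer ports).  Crux `RankOneAtTwoBigImageOddLocal` (stmt-BirchSwinnertonDyer-23715),
route `ByReductionTypeAtTwo`.  MEMO-es §50; census `CensusES52.md` (same directory; kit j344946 + j344966, tag `bsd-frontier-data`, two engines, 3746/3746 rows agree,
merged rows sha16 `b35ca477789fb0a2`); companion of the ES-51 workfile `KummerTangentES51.lean` (@7baf384fa095), whose frames are restated verbatim in §0 because
`Cruxes/**` modules are not built on the farm.  PARTITION 52421 = 17880 + 27650 + 3440 + 3451 (unchanged).  Beyond-print theorem: no.  BSD is not proved here.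

THE SETTING (as ES-51).  `W` on the 23715 slice with `Ш(W)[2] = 0` and generator class `κ(g)`; `F` globally minimal of the same conductor, congruent to `W` mod `2`, `#Sel₂(F) = 1`,
odd Tamagawa product; `V := W[2] = F[2]` (the identification is the UNIQUE `G_ℚ`-bijection of the 2-division abscissae, realised by `q ∈ ℚ[X]`, `θ_F = q(θ_W)`);
`γ_E := −Δ_E f_E′(θ_E) ∈ H¹(ℚ, V) ⊂ K^×/K^{×2}` the 4-division class, `β := γ_W γ_F` the `V`-part of the mod-4 defect of the congruence; `L_v(E) ⊂ H¹(ℚ_v, V)` the Kummer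
lines; `e_v := [L_v(W) ≠ L_v(F)]`.

§1 THE COUNT (corrects the mechanism sentence of ES-51, MEMO-es §49.2).  The Mazur–Rubin parity lemma does not apply to a non-twist pair (the Poonen–Rains forms differ:
`q_F = q_W + ⟨β,·⟩`); instead Greenberg–Wiles for the dual pair (relaxed `L_W + L_F`, strict `L_W ∩ L_F`) gives `d(W,F) := dim H¹_{L_W+L_F}(ℚ,V) = Σ_v e_v = e_∞ + e₂` on this
population (odd Tamagawa numbers identify the lines at odd multiplicative primes — the S-lemma —, odd additive primes have `H¹(ℚ_p, V) = 0`), and `κ(g), β ∈ H¹_{L_W+L_F}`.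
THE REAL PLACE IS A FLAG: for `Δ > 0`, `H¹(ℝ,V) = V`, `L_∞ = {0,(0,1,1)}` (sign vectors at `e₀<e₁<e₂`), `γ_∞ = (1,0,1)` (`deriv_signs_at_ordered_roots`), and `q` acts at `∞` as a
permutation `π` of the ordered roots — `RealRootFlag W F i :⟺ π(0) = i`.  Transport gives `e_∞ = [π ∉ {id, (12)}]`, `β_∞ ∈ {0, (0,1,1), (1,1,0)}` with `(1,1,0)` exactly when `π(0) = 1`.
FORCED (theorem-grade given the S-lemma): `Δ<0` or `π ∈ {id,(12)}` ⇒ `e₂ = 1`, `d = 1`, `β ∈ {0, κ(g)}` for EVERY reduction type at 2 with `W(ℚ₂)[2] = 0`; `π(0) = 1` ⇒ `β ∉ Sel₂(W)`,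
`d = 2`, both branches of the dichotomy fail (ES-52B); `π(0) = 2` ⇒ `e_∞ = 1` and `e₂ ∈ {0,1}` is free for the count — the LAW ES-52E says `e₂ = 0`.

§2 THE ROWS.  ES-52K `KummerWindowDichotomyAtTwo` (LAW; ES-51K with the window `TameAtTwo W ∨ (NoTwoAdicTwoTorsion W ∧ ¬ RealRootFlag W F 1)`; glue `dichotomy51_of_window52`);
ES-52B `RealWindowObstructionAtTwo` (THEOREM-CANDIDATE; glue `not_dichotomy_of_obstruction`); ES-52E `KummerLineCoincidenceAtTwo` (LAW) over the 2-adic predicate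
`LinesCoincideAtTwoVia W F q` (`x − θ_W ≡ x′ − q(θ_W)` mod squares of `ℚ₂[X]/(f_W)`); the sign lemma `deriv_signs_at_ordered_roots` (PROVED).

§3 CENSUS (CensusES52.md; oriented pairs `N < 10⁴` with `W(ℚ₂)[2] = 0`: 2376; two engines — square residues mod `pr^{2e+1}` (Sage) × `nfhilbert` symbol vectors (PARI) — agree on every
class, 3746/3746 rows incl. 1370 two-rank-1 control pairs).  Forced facts: `Δ<0 ⇒ e₂=1` 1598/1598; flags A/E ⇒ `e₂=1` 150/150; B/F ⇒ `e₂=1` 125/125; `e₂=0 ⇒ β ∈ L₂` 503/503.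
PRE-REGISTERED PREDICTION (job52/NOTES.md, before the run): flags C/D ⇒ `e₂ = 0` — **503/503**; `e₂ = 0 ⟺ flag ∈ {C,D}` among `Δ_W > 0` — **778/778**; 0 exceptions.  Control: on
two-rank-1 pairs the table flips (C/D ⇒ `e₂ = 1` 98/98, A/E ⇒ `e₂ = 0` 248/248) — `e₂` is global.  Side identities: `q_W(γ_W) = [(−2·disc, −2)₂ = −1] = [K₂/ℚ₂ unramified]` 3746/3746,
and then `γ_W` is the anisotropic class (1149/1149).
Why it might fail: ES-52E is a minimality statement for a relaxed Selmer group with no parity protection; ES-52K's C/D branch rests on it; ES-52B only on print ingredients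
(transposition reading of `a_ℓ mod 4`, Chebotarev in `S₄`, the sign lemma).  Nearest print: Mazur–Rubin arXiv:1203.0620 Thm 3.1 (for `p = 2` companions need `E₁[4] ≅ E₂[4]` and
potentially multiplicative reduction above 2) and Lemma 5.1 (local images generated by 4-division cocycles); Yu arXiv:1610.01195; arXiv:2506.23805; Poonen–Rains arXiv:1104.2105 §4;
Dummigan doi:10.5802/jtnb.548.  WHY NOVEL: print treats `E₁[2] ≅ E₂[2]`, `E₁[4] ≇ E₂[4]`, additive at 2 as the regime where Selmer comparison breaks down; ES-52 says the breakdown is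
rigid on the rank-1/`Sel₂`-trivial minimal-level population — the 2-adic discrepancy of the Kummer lines is read off the order in which `q` maps the real 2-division points.
-/

noncomputable section

open scoped Classical
open WeierstrassCurve Polynomial
open Literature.NumberTheory.EllipticCurves Literature.NumberTheory.EllipticCurves.ModularForms
open Summit.BirchSwinnertonDyer.Rank1Residual.F1Sign2 (LocallyTwoPowDivisible ShaTwoTrivial OnEgg)
open Summit.BirchSwinnertonDyer.Rank1Residual.F1Sign2.FirstDerivativeAtTwo (primeStar)

set_option linter.dupNamespace false
set_option autoImplicit false

namespace Summit.BirchSwinnertonDyer.BirchSwinnertonDyer.Cruxes.RankOneAtTwoBigImageOddLocal.ES52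

/-! ## §0 Frames restated VERBATIM from the ES-51 workfile `KummerTangentES51.lean` @7baf384fa095 (the farm does not build `Cruxes/**` modules, so the
import is replaced by restatement; `ES52.X` and `ES51.X` are syntactically identical for `X ∈ {CongruentModTwo, TameAtTwo, NoTwoAdicTwoTorsion,
KummerTangentDichotomyAtTwo}`). -/

/-- `CongruentModTwo W F` (ES-51 §1, verbatim): `a_p(W) ≡ a_p(F) (mod 2)` at every prime `p ∤ 2·N_W·N_F`. -/
def CongruentModTwo (W F : WeierstrassCurve ℚ) [W.IsGloballyMinimal] [F.IsGloballyMinimal] : Prop :=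
  ∀ p : ℕ, p.Prime → ¬ ((p : ℤ) ∣ 2 * (W.conductorNorm ℤ : ℤ) * (F.conductorNorm ℤ : ℤ)) →
    Even (W.frobeniusTrace p - F.frobeniusTrace p)

/-- `TameAtTwo W` (ES-51 §1, verbatim): `Δ_W < 0`, or multiplicative at `2`, or good supersingular at `2`. -/
def TameAtTwo (W : WeierstrassCurve ℚ) [W.IsElliptic] [W.IsGloballyMinimal] : Prop :=
  W.Δ < 0 ∨ W.HasMultiplicativeReductionAtPrime 2 ∨ (W.HasGoodReductionAtPrime 2 ∧ Even (W.frobeniusTrace 2))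

/-- `NoTwoAdicTwoTorsion W` (ES-51 §1, verbatim): `W(ℚ₂)[2] = 0`. -/
def NoTwoAdicTwoTorsion (W : WeierstrassCurve ℚ) : Prop :=
  ∀ x : ℚ_[2], ((W.map (algebraMap ℚ ℚ_[2])).twoTorsionPolynomial).toPoly.eval x ≠ 0

/-- **ES-51K `KummerTangentDichotomyAtTwo`** (ES-51 §1, statement verbatim; LAW, census 3145/3145). -/
@[conjecture] def KummerTangentDichotomyAtTwo : Prop :=
  ∀ (W : WeierstrassCurve ℚ) [W.IsElliptic] [W.IsGloballyMinimal],
    ¬ W.HasCM → (∀ k : ℕ, W.HasSurjectiveModNGaloisRep ((2 ^ k : ℕ) : ℤ)) → Odd W.torsionOrder → Odd W.tamagawaProduct →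
    W.analyticRank = 1 → ShaTwoTrivial W → TameAtTwo W →
    ∀ (g : (W.toAffine.baseChange ℚ).Point), (∀ Q : (W.toAffine.baseChange ℚ).Point, 2 • Q ≠ g) →
    ∀ (F : WeierstrassCurve ℚ) [F.IsElliptic] [F.IsGloballyMinimal],
      F.conductorNorm ℤ = W.conductorNorm ℤ → CongruentModTwo W F → Nat.card (F.selmerGroup (2 : ℤ)) = 1 → Odd F.tamagawaProduct →
      (∀ (ℓ : ℕ) [Fact ℓ.Prime], ¬ ((ℓ : ℤ) ∣ 2 * (W.conductorNorm ℤ : ℤ)) → jacobiSym W.Δ.num ℓ = -1 →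
          (4 : ℤ) ∣ W.frobeniusTrace ℓ - F.frobeniusTrace ℓ) ∨
      (∀ (ℓ : ℕ) [Fact ℓ.Prime], ¬ ((ℓ : ℤ) ∣ 2 * (W.conductorNorm ℤ : ℤ)) → jacobiSym W.Δ.num ℓ = -1 →
          ((4 : ℤ) ∣ W.frobeniusTrace ℓ - F.frobeniusTrace ℓ ↔ LocallyTwoPowDivisible W ℓ 1 g))

/-! ## §1 ES-52 — the real-root flag, the window law, the obstruction -/

/-- The 2-division polynomial `4X³ + b₂X² + 2b₄X + b₆ ∈ ℚ[X]` of `W` (roots = abscissae of the 2-torsion points). -/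
def twoDivPoly (W : WeierstrassCurve ℚ) : Polynomial ℚ := W.twoTorsionPolynomial.toPoly

/-- `RealRootFlag W F i` (`i : Fin 3`, 0-indexed): there is `q ∈ ℚ[X]` carrying the 2-torsion abscissae of `W` to those of `F`
(`f_W ∣ f_F ∘ q`, i.e. `θ_F := q(θ_W)` realises `ℚ(W[2]) = ℚ(F[2])`; for `S₃` image this `q` induces the UNIQUE `G_ℚ`-bijection of the root sets,
`Aut_{S₃}(S₃/C₂) = 1`), both 2-division cubics have three real roots `e₀ < e₁ < e₂`, `e'₀ < e'₁ < e'₂`, and `q` sends the SMALLEST root of `W` to the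
`i`-th root of `F`: `q(e₀) = e'_i`.  The flag is the relative position of the two real Kummer lines `L_∞(W)`, `L_∞(F)` and of the two archimedean
4-division classes inside `H¹(ℝ, W[2]) = W[2]` (ES-52 §1). -/
def RealRootFlag (W F : WeierstrassCurve ℚ) (i : Fin 3) : Prop :=
  ∃ (q : Polynomial ℚ) (e e' : Fin 3 → ℝ),
    twoDivPoly W ∣ (twoDivPoly F).comp q ∧ StrictMono e ∧ StrictMono e' ∧
    (∀ j, ((twoDivPoly W).map (algebraMap ℚ ℝ)).eval (e j) = 0) ∧ (∀ j, ((twoDivPoly F).map (algebraMap ℚ ℝ)).eval (e' j) = 0) ∧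
    ((q.map (algebraMap ℚ ℝ)).eval (e 0)) = e' i

/-- **ES-52K `KummerWindowDichotomyAtTwo` (LAW; = ES-51K with the window at `2` widened from `TameAtTwo W` to
`TameAtTwo W ∨ (W(ℚ₂)[2] = 0 ∧ ¬ RealRootFlag W F 1)`).**  Same frame and conclusion as ES-51K.  Census K51D (N < 10⁴, hygienic `F`): 3532/3532
(ES-51K's 3137 + 395 additive-at-2 pairs with `n₂(W) = 0` in flags A/C/D/E; E52 re-derivation from the 2-adic lines: 2171/2171 hygienic pairs with `n₂(W) = 0` outside flag `1`); the excluded flag `1` («middle root», cases B/F) is exactly where the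
dichotomy is IMPOSSIBLE (ES-52B).  MECHANISM: `d(W,F) = e_∞ + e₂` (Greenberg–Wiles count of the relaxed-minus-strict Selmer groups for the lines `L_v(W), L_v(F)`),
`e_∞ = [flag ∈ {B,C,D,F}]`, `κ(g), β ∈ H¹_{L_W+L_F}` of dimension `d`; flags A/E and `Δ < 0`: `e_∞ = 0 ⇒ d = e₂ = 1 ⇒ β ∈ {0, κ(g)}` (theorem-grade given the S-lemma);
flags C/D: by the line-coincidence law ES-52E (`e₂ = 0`).  Why it might fail: the C/D branch rests on ES-52E (a law, not a theorem); the `n₂ ≥ 1` additive corner is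
outside the window. -/
@[conjecture] def KummerWindowDichotomyAtTwo : Prop :=
  ∀ (W : WeierstrassCurve ℚ) [W.IsElliptic] [W.IsGloballyMinimal],
    ¬ W.HasCM → (∀ k : ℕ, W.HasSurjectiveModNGaloisRep ((2 ^ k : ℕ) : ℤ)) → Odd W.torsionOrder → Odd W.tamagawaProduct →
    W.analyticRank = 1 → ShaTwoTrivial W →
    ∀ (g : (W.toAffine.baseChange ℚ).Point), (∀ Q : (W.toAffine.baseChange ℚ).Point, 2 • Q ≠ g) →
    ∀ (F : WeierstrassCurve ℚ) [F.IsElliptic] [F.IsGloballyMinimal],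
      F.conductorNorm ℤ = W.conductorNorm ℤ → CongruentModTwo W F → Nat.card (F.selmerGroup (2 : ℤ)) = 1 → Odd F.tamagawaProduct →
      (TameAtTwo W ∨ (NoTwoAdicTwoTorsion W ∧ ¬ RealRootFlag W F 1)) →
      (∀ (ℓ : ℕ) [Fact ℓ.Prime], ¬ ((ℓ : ℤ) ∣ 2 * (W.conductorNorm ℤ : ℤ)) → jacobiSym W.Δ.num ℓ = -1 →
          (4 : ℤ) ∣ W.frobeniusTrace ℓ - F.frobeniusTrace ℓ) ∨
      (∀ (ℓ : ℕ) [Fact ℓ.Prime], ¬ ((ℓ : ℤ) ∣ 2 * (W.conductorNorm ℤ : ℤ)) → jacobiSym W.Δ.num ℓ = -1 →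
          ((4 : ℤ) ∣ W.frobeniusTrace ℓ - F.frobeniusTrace ℓ ↔ LocallyTwoPowDivisible W ℓ 1 g))

/-- KERNEL GLUE: the window law ES-52K contains the tangent law ES-51K (instantiate the window with `TameAtTwo W`). -/
theorem dichotomy51_of_window52 (h : KummerWindowDichotomyAtTwo) : KummerTangentDichotomyAtTwo := by
  intro W _ _ hcm hsurj htor htam hrk hsha htame g hg F _ _ hN hcong hsel htamF
  exact h W hcm hsurj htor htam hrk hsha g hg F hN hcong hsel htamF (Or.inl htame)

/-- **ES-52B `RealWindowObstructionAtTwo` (THEOREM-CANDIDATE, support): in the middle-root flag BOTH branches of the dichotomy FAIL.**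
Frame of ES-51K without any hypothesis at `2`; if `RealRootFlag W F 1` then (i) the congruence does not lift mod `4` on the transposition locus
(some `ℓ ∤ 2N` with `(Δ_W/ℓ) = −1` has `4 ∤ a_ℓ(W) − a_ℓ(F)`) and (ii) the mod-`4` defect is not the Kummer class of `g` either.  Proof sketch (all print /
elementary): `β = γ_W γ_F ∈ H¹(ℚ, V)`, `γ_E = −Δ_E f_E'(θ_E)` has archimedean signs `(−,+,−)` at `e₀<e₁<e₂`, so `β_∞ = (1,1,0) ∉ L_∞(W) = {0, (0,1,1)}` exactly in flag `1`;
`0, κ(g) ∈ Sel₂(W)` have `∞`-component in `L_∞(W)`; hence `β ∉ {0, κ(g)}`; the transposition reading `4 ∣ a_ℓ(W) − a_ℓ(F) ⟺ res_ℓ β = 0` (`H¹(G, sl₂(𝔽₂)) = H¹(G,𝔽₂) ⊕ H¹(G,V)`,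
the scalar part is invisible where `a_ℓ` is even) and Chebotarev in `Gal = V ⋊ S₃ ≅ S₄` turn `β ≠ 0`, `β ≠ κ(g)` into the failure of (i)'s and (ii)'s universal statements.
Census K51D: flags B/F ⟹ verdict «other» **182/182** (all `n₂`; E52: `β ≠ 0` and `β ≢ κ(g)` at `2` or globally, 125/125 with `n₂ = 0`).  Why it might fail: only if the transposition reading of `a_ℓ mod 4` were wrong — it is checked on
7 398 894 digit pairs (K51B). -/
def RealWindowObstructionAtTwo : Prop :=
  ∀ (W : WeierstrassCurve ℚ) [W.IsElliptic] [W.IsGloballyMinimal],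
    ¬ W.HasCM → (∀ k : ℕ, W.HasSurjectiveModNGaloisRep ((2 ^ k : ℕ) : ℤ)) → Odd W.torsionOrder → Odd W.tamagawaProduct →
    W.analyticRank = 1 → ShaTwoTrivial W →
    ∀ (g : (W.toAffine.baseChange ℚ).Point), (∀ Q : (W.toAffine.baseChange ℚ).Point, 2 • Q ≠ g) →
    ∀ (F : WeierstrassCurve ℚ) [F.IsElliptic] [F.IsGloballyMinimal],
      F.conductorNorm ℤ = W.conductorNorm ℤ → CongruentModTwo W F → Nat.card (F.selmerGroup (2 : ℤ)) = 1 → Odd F.tamagawaProduct →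
      RealRootFlag W F 1 →
      (∃ (ℓ : ℕ) (_ : Fact ℓ.Prime), ¬ ((ℓ : ℤ) ∣ 2 * (W.conductorNorm ℤ : ℤ)) ∧ jacobiSym W.Δ.num ℓ = -1 ∧
          ¬ (4 : ℤ) ∣ W.frobeniusTrace ℓ - F.frobeniusTrace ℓ) ∧
      (∃ (ℓ : ℕ) (_ : Fact ℓ.Prime), ¬ ((ℓ : ℤ) ∣ 2 * (W.conductorNorm ℤ : ℤ)) ∧ jacobiSym W.Δ.num ℓ = -1 ∧
          ¬ ((4 : ℤ) ∣ W.frobeniusTrace ℓ - F.frobeniusTrace ℓ ↔ LocallyTwoPowDivisible W ℓ 1 g))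


/-- `LinesCoincideAtTwoVia W F q`: inside the étale cubic `ℚ₂`-algebra `K₂ = ℚ₂[X]/(f_W)` (`θ_W :=` the class of `X`, `θ_F := q(θ_W)`), every
non-zero point `(x, y) ∈ W(ℚ₂)` has a non-zero point `(x', y') ∈ F(ℚ₂)` with `x − θ_W ≡ x' − θ_F (mod (K₂ˣ)²)`.  When `W(ℚ₂)[2] = 0` (`K₂` a field,
`#W(ℚ₂)/2W(ℚ₂) = #F(ℚ₂)/2F(ℚ₂) = 2`) this says exactly that the two KUMMER LINES coincide: `L₂(W) = L₂(F)` inside `H¹(ℚ₂, W[2]) = ker(N : K₂ˣ/□ → ℚ₂ˣ/□)`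
(the `x − θ` Kummer map is model-independent: `y ↦ y + (a₁x + a₃)/2` does not move `x`). [cite: SilvermanAEC2009, X.1.4] [cite: Cassels1991, §15] -/
def LinesCoincideAtTwoVia (W F : WeierstrassCurve ℚ) (q : Polynomial ℚ) : Prop :=
  ∀ x y : ℚ_[2], (W.map (algebraMap ℚ ℚ_[2])).toAffine.Nonsingular x y →
    ∃ x' y' : ℚ_[2], (F.map (algebraMap ℚ ℚ_[2])).toAffine.Nonsingular x' y' ∧
      ∃ u : AdjoinRoot ((twoDivPoly W).map (algebraMap ℚ ℚ_[2])), IsUnit u ∧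
        algebraMap ℚ_[2] (AdjoinRoot ((twoDivPoly W).map (algebraMap ℚ ℚ_[2]))) x
            - AdjoinRoot.root ((twoDivPoly W).map (algebraMap ℚ ℚ_[2]))
          = u ^ 2 * (algebraMap ℚ_[2] (AdjoinRoot ((twoDivPoly W).map (algebraMap ℚ ℚ_[2]))) x'
            - AdjoinRoot.mk ((twoDivPoly W).map (algebraMap ℚ ℚ_[2])) (q.map (algebraMap ℚ ℚ_[2])))

/-- **ES-52E `KummerLineCoincidenceAtTwo` (LAW — the LINE-COINCIDENCE LAW; census E52 kit j344946 + j344966, merged rows sha16 `b35ca477789fb0a2`: 778/778 oriented pairs with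
`Δ_W > 0`, `W(ℚ₂)[2] = 0`, N < 10⁴; two engines, 3746/3746 rows agree).**  Frame of ES-51K (W on the 23715 slice with `Ш(W)[2] = 0`; `F` globally minimal, same conductor, congruent mod 2,
`#Sel₂(F) = 1`, odd Tamagawa product); `Δ_W > 0`, `W(ℚ₂)[2] = 0`; `q ∈ ℚ[X]` the root correspondence (`f_W ∣ f_F ∘ q`) and `e₀<e₁<e₂`, `e'₀<e'₁<e'₂` the real
2-division abscissae.  THEN the 2-adic Kummer lines of `W` and `F` COINCIDE iff `q` maps the smallest real root of `W` to the LARGEST real root of `F`: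
`L₂(W) = L₂(F) ⟺ q(e₀) = e'₂`.  Census: flags C/D (`q(e₀) = e'₂`): `e₂ = 0` in **503/503** (C 238, D 265; ramified cubic 468, unramified 35); flags A/B/E/F:
`e₂ = 1` in **275/275**; `Δ_W < 0`: `e₂ = 1` in 1598/1598.  MECHANISM: `(⟹)` is theorem-grade — `d(W,F) := dim H¹_{L_W+L_F}(ℚ,V) = e_∞ + e₂` (Greenberg–Wiles for the
relaxed/strict pair, S-lemma at odd primes), `e_∞ = [L_∞(W) ≠ L_∞(F)] = 0` exactly in flags A/E (`L_∞ = {0,(0,1,1)}` transported by the flag), `κ(g) ∈ H¹_{L_W+L_F} ∖ 0`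
forces `d ≥ 1`, and in flags B/F `β_∞ = (1,1,0) ∉ L_∞(W)` gives `β ∉ Sel₂(W)`, `d = 2`; `(⟸)` — flags C/D have `e_∞ = 1` and the count allows `e₂ ∈ {0,1}`: the law says
the relaxed Selmer group is MINIMAL there (`d = 1`, `H¹_{L_W+L_F} = Sel₂(W)`).  Contrast (same job): for pairs of TWO rank-1 curves the table flips (flags C/D:
`e₂ = 1` 98/98, A/E: `e₂ = 0` 248/248) — `e₂` is not a function of the two local curves at `2` but of the Selmer configuration: the global classes choose the lines.
Why it might fail: it is a minimality statement for a relaxed Selmer group with no parity protection (`d = 2` with `β ∈ Sel₂(W)` is excluded by no count);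
a pair with an extra class in `H¹_{L_W+L_F}` invisible to `β` kills it.  [new: -es g41 §50] -/
@[conjecture] def KummerLineCoincidenceAtTwo : Prop :=
  ∀ (W : WeierstrassCurve ℚ) [W.IsElliptic] [W.IsGloballyMinimal],
    ¬ W.HasCM → (∀ k : ℕ, W.HasSurjectiveModNGaloisRep ((2 ^ k : ℕ) : ℤ)) → Odd W.torsionOrder → Odd W.tamagawaProduct →
    W.analyticRank = 1 → ShaTwoTrivial W → 0 < W.Δ → NoTwoAdicTwoTorsion W →
    ∀ (F : WeierstrassCurve ℚ) [F.IsElliptic] [F.IsGloballyMinimal],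
      F.conductorNorm ℤ = W.conductorNorm ℤ → CongruentModTwo W F → Nat.card (F.selmerGroup (2 : ℤ)) = 1 → Odd F.tamagawaProduct →
      ∀ (q : Polynomial ℚ) (e e' : Fin 3 → ℝ), twoDivPoly W ∣ (twoDivPoly F).comp q → StrictMono e → StrictMono e' →
        (∀ j, ((twoDivPoly W).map (algebraMap ℚ ℝ)).eval (e j) = 0) → (∀ j, ((twoDivPoly F).map (algebraMap ℚ ℝ)).eval (e' j) = 0) →
        (LinesCoincideAtTwoVia W F q ↔ (q.map (algebraMap ℚ ℝ)).eval (e 0) = e' 2)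

/-- KERNEL GLUE (pure logic): ES-52B says the window of ES-52K cannot be widened to flag `1` — under `RealRootFlag W F 1` the dichotomy's conclusion is false. -/
theorem not_dichotomy_of_obstruction (h : RealWindowObstructionAtTwo)
    (W : WeierstrassCurve ℚ) [W.IsElliptic] [W.IsGloballyMinimal]
    (hcm : ¬ W.HasCM) (hsurj : ∀ k : ℕ, W.HasSurjectiveModNGaloisRep ((2 ^ k : ℕ) : ℤ)) (htor : Odd W.torsionOrder)
    (htam : Odd W.tamagawaProduct) (hrk : W.analyticRank = 1) (hsha : ShaTwoTrivial W)
    (g : (W.toAffine.baseChange ℚ).Point) (hg : ∀ Q : (W.toAffine.baseChange ℚ).Point, 2 • Q ≠ g)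
    (F : WeierstrassCurve ℚ) [F.IsElliptic] [F.IsGloballyMinimal]
    (hN : F.conductorNorm ℤ = W.conductorNorm ℤ) (hcong : CongruentModTwo W F) (hsel : Nat.card (F.selmerGroup (2 : ℤ)) = 1)
    (htamF : Odd F.tamagawaProduct) (hflag : RealRootFlag W F 1) :
    ¬ ((∀ (ℓ : ℕ) [Fact ℓ.Prime], ¬ ((ℓ : ℤ) ∣ 2 * (W.conductorNorm ℤ : ℤ)) → jacobiSym W.Δ.num ℓ = -1 →
          (4 : ℤ) ∣ W.frobeniusTrace ℓ - F.frobeniusTrace ℓ) ∨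
      (∀ (ℓ : ℕ) [Fact ℓ.Prime], ¬ ((ℓ : ℤ) ∣ 2 * (W.conductorNorm ℤ : ℤ)) → jacobiSym W.Δ.num ℓ = -1 →
          ((4 : ℤ) ∣ W.frobeniusTrace ℓ - F.frobeniusTrace ℓ ↔ LocallyTwoPowDivisible W ℓ 1 g))) := by
  obtain ⟨⟨ℓ₁, hp₁, hn₁, hj₁, h₁⟩, ⟨ℓ₂, hp₂, hn₂, hj₂, h₂⟩⟩ :=
    h W hcm hsurj htor htam hrk hsha g hg F hN hcong hsel htamF hflag
  rintro (hall | hsec)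
  · exact h₁ (@hall ℓ₁ hp₁ hn₁ hj₁)
  · exact h₂ (@hsec ℓ₂ hp₂ hn₂ hj₂)

/-- SIGN LEMMA (support, PROVED): for real numbers `e₀ < e₁ < e₂` and `c > 0`, the derivative of `c (X − e₀)(X − e₁)(X − e₂)` is positive at `e₀` and `e₂`
and negative at `e₁` — the archimedean sign vector `(−,+,−)` of the 4-division class `γ = −Δ f'(θ)` (`Δ > 0`). -/
theorem deriv_signs_at_ordered_roots (c e₀ e₁ e₂ : ℝ) (hc : 0 < c) (h01 : e₀ < e₁) (h12 : e₁ < e₂) :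
    0 < c * ((e₀ - e₁) * (e₀ - e₂)) ∧ c * ((e₁ - e₀) * (e₁ - e₂)) < 0 ∧ 0 < c * ((e₂ - e₀) * (e₂ - e₁)) := by
  refine ⟨?_, ?_, ?_⟩
  · exact mul_pos hc (mul_pos_of_neg_of_neg (by linarith) (by linarith))
  · exact mul_neg_of_pos_of_neg hc (mul_neg_of_pos_of_neg (by linarith) (by linarith))
  · exact mul_pos hc (mul_pos (by linarith) (by linarith))

end Summit.BirchSwinnertonDyer.BirchSwinnertonDyer.Cruxes.RankOneAtTwoBigImageOddLocal.ES52

end
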